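import Summits.ValiantsHypothesis.ValiantsHypothesis.Theorems.SymPencilBasePointFamily

/-!
# Route `SymPencil` — cyclic isotropy of the kernel rows along an affine kernel direction
# (tool file for the size-`27` one-row cell `(12,4,2)`, `--supports` stmt-ValiantsHypothesis-5674;
# rung currency for `sdc(per_4)`, nothing here bears on `VP ≠ VNP`)

Two pieces of matrix algebra and one reading of the base-point package.

* `map_coeff_adjugate_one_add_eq` — the FULL expansion `adj (1 + X T) = Σ_n X^n 𝔞_n` with
  `𝔞_n = Σ_{i ≤ n} (-1)^i d_{n-i} T^i` (`d_j` the coefficients of `det (1 + X T)`), extending the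
  second-order expansion of `SymPencilAdjugateExpansion`; hence (`coeff_bilin_adjugate_line_eq`)
  the `n`-th coefficient of `yᵀ adj (D + X N) y'` is
  `det D · Σ_{i ≤ n} (-1)^i d_{n-i} yᵀ(D⁻¹N)^i D⁻¹ y'`.
* `cyclic_isotropy` — if `yᵀ (D + s N)⁻¹ y' = 0` for every `s` with `D + s N` invertible, then
  `yᵀ (D⁻¹ N)^n D⁻¹ y' = 0` for EVERY `n`: the bilinear polynomial `yᵀ adj (D + X N) y'` has
  infinitely many roots, so all its coefficients vanish, and the triangular system above is solved
  by strong induction.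
* `cyclic_isotropy_of_affine` — in the base-point package of a symmetric representation of `per_4`
  (`SymPencilPerFourBasePointPackage`), for a kernel direction `v` along which `per_4` is affine
  (a one-row / one-column `v`), the square family `S(z, s v)` vanishes, so by
  `SymPencilBasePointFamily.basepoint_family` the kernel rows are `(D + s C(v))⁻¹`-isotropic for
  ALL `s`, whence `b(z)ᵀ D⁻¹ (C(v) D⁻¹)^n b(z') = 0` for all `n, z, z'`: the `C(v)D⁻¹`-cyclic span
  of `im b` is totally `D⁻¹`-isotropic (and `C(v)D⁻¹`-invariant).  At defect `≤ 1` this recovers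
  the kernel invariance of `SymPencilKernelInvariance`; at defect `2` (cell `(12,4,2)`, size `27`)
  it leaves exactly the alternative "invariant, or `im b ⊕ K t₁` Lagrangian and invariant" of
  `Cruxes/SdcPerBeyondN/NEXT-RUNG-H7.md` (H7.6).  No cell is closed here. [folklore]
-/

noncomputable section

-- single-conjunct layout: Sub = Summit, duplicated namespace component intended
set_option linter.dupNamespace false

namespace Summit.ValiantsHypothesis.ValiantsHypothesis.Theorems.SymPencilCyclicIsotropy

open Matrix Polynomial MvPolynomial
open Literature.Computability.AlgebraicComplexity
open Summit.ValiantsHypothesis.ValiantsHypothesis.Theorems.SymPencilHomogeneousDropTools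
open Summit.ValiantsHypothesis.ValiantsHypothesis.Theorems.SymPencilAdjugateExpansion
open Summit.ValiantsHypothesis.ValiantsHypothesis.Theorems.SymPencilOriginMoments
open Summit.ValiantsHypothesis.ValiantsHypothesis.Theorems.SymPencilLagrangianKernel
open Summit.ValiantsHypothesis.ValiantsHypothesis.Theorems.SymPencilBasePointFamily

universe u

variable {k : Type u} [Field k] {ι : Type*} [Fintype ι] [DecidableEq ι]

/-- **Full expansion of `adj (1 + X T)`**: the coefficient of `X ^ n` is
`Σ_{i ≤ n} (-1)^i d_{n-i} T^i`, `d_j` the coefficients of `det (1 + X T)`. [folklore] -/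
theorem map_coeff_adjugate_one_add_eq (T : Matrix ι ι k) (n : ℕ) :
    (adjugate (1 + (Polynomial.X : k[X]) • T.map Polynomial.C)).map (fun p : k[X] => p.coeff n) =
      ∑ i ∈ Finset.range (n + 1),
        ((-1 : k) ^ i * (det (1 + (Polynomial.X : k[X]) • T.map Polynomial.C)).coeff (n - i)) •
          T ^ i := by
  obtain ⟨h0, hrel⟩ := map_coeff_adjugate_one_add_rel T
  have hd0 : (det (1 + (Polynomial.X : k[X]) • T.map Polynomial.C)).coeff 0 = 1 := by
    have h := coeff_detLine_zero (1 : Matrix ι ι k) T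
    rwa [Matrix.map_one Polynomial.C (map_zero _) (map_one _), Matrix.det_one] at h
  induction n with
  | zero =>
    rw [h0, Finset.sum_range_one]
    simp [hd0]
  | succ n ih =>
    have h := hrel n
    rw [ih] at h
    rw [eq_sub_of_add_eq h, Finset.sum_range_succ' _ (n + 1)]
    simp only [pow_zero, one_mul, Nat.sub_zero, pow_succ, Finset.sum_mul, Matrix.smul_mul,
      Nat.succ_sub_succ_eq_sub]
    rw [sub_eq_add_neg, add_comm, ← Finset.sum_neg_distrib]
    congr 1
    refine Finset.sum_congr rfl fun i _ => ?_
    rw [← neg_smul]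
    congr 1
    ring

/-- **All coefficients of `yᵀ adj (D + X N) y'`** for invertible `D`:
`g_n = det D · Σ_{i ≤ n} (-1)^i d_{n-i} · yᵀ (D⁻¹N)^i D⁻¹ y'`. [folklore] -/
theorem coeff_bilin_adjugate_line_eq {D : Matrix ι ι k} (hD : IsUnit D.det) (N : Matrix ι ι k)
    (y y' : ι → k) (n : ℕ) :
    ((fun i => Polynomial.C (y i)) ⬝ᵥ
        adjugate (D.map Polynomial.C + (Polynomial.X : k[X]) • N.map Polynomial.C) *ᵥ
        (fun i => Polynomial.C (y' i))).coeff n =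
      D.det * ∑ i ∈ Finset.range (n + 1),
        ((-1 : k) ^ i *
          (det (1 + (Polynomial.X : k[X]) • (D⁻¹ * N).map Polynomial.C)).coeff (n - i)) *
          (y ⬝ᵥ ((D⁻¹ * N) ^ i * D⁻¹) *ᵥ y') := by
  have hadj : adjugate D = D.det • D⁻¹ := by
    rw [Matrix.nonsing_inv_apply _ hD, smul_smul, IsUnit.mul_val_inv, one_smul]
  rw [coeff_cvec_dotProduct_mulVec, adjugate_line_eq hD, map_coeff_mul_map_C, hadj,
    map_coeff_adjugate_one_add_eq, Matrix.mul_smul, Matrix.smul_mulVec, dotProduct_smul,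
    smul_eq_mul, Finset.sum_mul, Matrix.sum_mulVec, dotProduct_sum, Finset.mul_sum, Finset.mul_sum]
  refine Finset.sum_congr rfl fun i _ => ?_
  rw [Matrix.smul_mul, Matrix.smul_mulVec, dotProduct_smul, smul_eq_mul]

/-- **Cyclic isotropy.**  If `yᵀ (D + s N)⁻¹ y' = 0` whenever `D + s N` is invertible (`D`
invertible, `k` of characteristic `0`), then `yᵀ (D⁻¹ N)^n D⁻¹ y' = 0` for every `n`. [folklore] -/
theorem cyclic_isotropy [CharZero k] {D : Matrix ι ι k} (hD : IsUnit D.det) (N : Matrix ι ι k)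
    (y y' : ι → k) (h : ∀ s : k, IsUnit (D + s • N).det → y ⬝ᵥ (D + s • N)⁻¹ *ᵥ y' = 0) (n : ℕ) :
    y ⬝ᵥ ((D⁻¹ * N) ^ n * D⁻¹) *ᵥ y' = 0 := by
  classical
  have hD0 : D.det ≠ 0 := hD.ne_zero
  set δ : k[X] := (D.map Polynomial.C + (Polynomial.X : k[X]) • N.map Polynomial.C).det with hδ
  set g : k[X] := (fun i => Polynomial.C (y i)) ⬝ᵥ
      adjugate (D.map Polynomial.C + (Polynomial.X : k[X]) • N.map Polynomial.C) *ᵥ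
      (fun i => Polynomial.C (y' i)) with hg
  have hroot : ∀ s : k, (D + s • N).det ≠ 0 → g.IsRoot s := by
    intro s hs
    have hSu : IsUnit (D + s • N).det := isUnit_iff_ne_zero.2 hs
    have hadj : adjugate (D + s • N) = (D + s • N).det • (D + s • N)⁻¹ := by
      rw [Matrix.nonsing_inv_apply _ hSu, smul_smul, IsUnit.mul_val_inv, one_smul]
    rw [Polynomial.IsRoot.def, hg, eval_bilin_adjugate_line, hadj, Matrix.smul_mulVec,
      dotProduct_smul, smul_eq_mul, h s hSu, mul_zero]
  have hg0 : g = 0 := by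
    apply Polynomial.eq_zero_of_infinite_isRoot
    have hδ0 : δ ≠ 0 := by
      intro h0
      have h1 := coeff_detLine_zero D N
      rw [← hδ, h0, Polynomial.coeff_zero] at h1
      exact hD0 h1.symm
    have hfin : Set.Finite {s : k | δ.IsRoot s} := (δ.roots.toFinset.finite_toSet).subset
      fun s hs => by
        simp only [Set.mem_setOf_eq] at hs
        simp only [Finset.mem_coe, Multiset.mem_toFinset, Polynomial.mem_roots hδ0]
        exact hs
    refine (hfin.infinite_compl).mono fun s hs => ?_
    simp only [Set.mem_compl_iff, Set.mem_setOf_eq, Polynomial.IsRoot.def, hδ, eval_detLine] at hs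
    exact hroot s hs
  have hd0 : (det (1 + (Polynomial.X : k[X]) • (D⁻¹ * N).map Polynomial.C)).coeff 0 = 1 := by
    have h1 := coeff_detLine_zero (1 : Matrix ι ι k) (D⁻¹ * N)
    rwa [Matrix.map_one Polynomial.C (map_zero _) (map_one _), Matrix.det_one] at h1
  -- strong induction on `n`
  induction n using Nat.strong_induction_on with
  | _ n ih =>
    have hc := coeff_bilin_adjugate_line_eq hD N y y' n
    rw [← hg, hg0, Polynomial.coeff_zero, Finset.sum_range_succ] at hc
    have hzero : ∑ i ∈ Finset.range n, ((-1 : k) ^ i *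
        (det (1 + (Polynomial.X : k[X]) • (D⁻¹ * N).map Polynomial.C)).coeff (n - i)) *
        (y ⬝ᵥ ((D⁻¹ * N) ^ i * D⁻¹) *ᵥ y') = 0 :=
      Finset.sum_eq_zero fun i hi => by rw [ih i (Finset.mem_range.1 hi), mul_zero]
    rw [hzero, zero_add, Nat.sub_self, hd0, mul_one] at hc
    have h2 : (-1 : k) ^ n * (y ⬝ᵥ ((D⁻¹ * N) ^ n * D⁻¹) *ᵥ y') = 0 :=
      (mul_eq_zero.1 hc.symm).resolve_left hD0
    exact (mul_eq_zero.1 h2).resolve_left (pow_ne_zero _ (neg_ne_zero.2 one_ne_zero))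

variable [CharZero k] {ι' : Type*} [Fintype ι'] [DecidableEq ι']

/-- **Cyclic isotropy of the kernel rows along an affine kernel direction** (interface for the cell
`(12,4,2)`).  In the base-point package, if `bL v = 0` and `per_4` is affine along `v`, then
`b(z)ᵀ (D⁻¹C(v))^n D⁻¹ b(z') = 0` for all `n, z, z'`. [folklore] -/
theorem cyclic_isotropy_of_affine {D : Matrix ι' ι' k} (hD : IsUnit D.det) (hDs : Dᵀ = D)
    (bL : (Fin 4 × Fin 4 → k) →ₗ[k] (ι' → k)) (CL : (Fin 4 × Fin 4 → k) →ₗ[k] Matrix ι' ι' k)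
    (hCs : ∀ z, (CL z)ᵀ = CL z) {κ : k} (hκ : κ ≠ 0)
    (hN : ∀ v, bL v = 0 → IsUnit (D + CL v).det ∧ ∀ (z : Fin 4 × Fin 4 → k) (s : k),
      κ * MvPolynomial.eval (v + s • z) (perPoly (Fin 4) k) =
        (Matrix.fromBlocks ((s * 0) • (1 : Matrix Unit Unit k))
          (Matrix.replicateRow Unit (s • bL z)) (Matrix.replicateCol Unit (s • bL z))
          (D + CL v + s • CL z)).det)
    (v : Fin 4 × Fin 4 → k) (hv : bL v = 0)
    (haff : ∀ z, ∃ e₀ e₁ : k, ∀ s : k,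
      MvPolynomial.eval (z + s • v) (perPoly (Fin 4) k) = e₀ + s * e₁)
    (z z' : Fin 4 × Fin 4 → k) (n : ℕ) :
    bL z ⬝ᵥ ((D⁻¹ * CL v) ^ n * D⁻¹) *ᵥ bL z' = 0 := by
  -- the kernel rows are `(D + s C(v))⁻¹`-isotropic for every `s`
  have hq : ∀ (s : k) (w : Fin 4 × Fin 4 → k),
      bL w ⬝ᵥ (D + s • CL v)⁻¹ *ᵥ bL w = 0 := by
    intro s w
    have hsv : bL (s • v) = 0 := by rw [map_smul, hv, smul_zero]
    obtain ⟨e₀, e₁, he⟩ := haff w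
    have hexp : ∀ s' : k, MvPolynomial.eval (w + s' • (s • v)) (perPoly (Fin 4) k) =
        e₀ + s' * (s * e₁) + s' ^ 2 * 0 := fun s' => by
      rw [smul_smul, he]; ring
    have hu : IsUnit (D + s • CL v).det := by
      have h := (hN (s • v) hsv).1
      rwa [map_smul] at h
    obtain ⟨h1, -⟩ := basepoint_family bL CL hN hκ (s • v) hsv w e₀ (s * e₁) 0 hexp
    rw [mul_zero, neg_zero, map_smul] at h1
    exact (mul_eq_zero.1 h1).resolve_left hu.ne_zero
  -- polarisation: `(D + s C(v))⁻¹` is symmetric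
  have hsym : ∀ s : k, ((D + s • CL v)⁻¹)ᵀ = (D + s • CL v)⁻¹ := fun s => by
    rw [Matrix.transpose_nonsing_inv, Matrix.transpose_add, Matrix.transpose_smul, hDs, hCs]
  have hbil : ∀ s : k, IsUnit (D + s • CL v).det → bL z ⬝ᵥ (D + s • CL v)⁻¹ *ᵥ bL z' = 0 := by
    intro s _
    have h1 := hq s (z + z')
    rw [map_add, Matrix.mulVec_add, dotProduct_add, add_dotProduct, add_dotProduct, hq s z,
      hq s z', dotProduct_mulVec_of_transpose_eq (hsym s) (bL z'), dotProduct_comm (_ *ᵥ bL z'),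
      zero_add, add_zero, ← two_mul] at h1
    exact (mul_eq_zero.1 h1).resolve_left two_ne_zero
  exact cyclic_isotropy hD (CL v) (bL z) (bL z') hbil n

end Summit.ValiantsHypothesis.ValiantsHypothesis.Theorems.SymPencilCyclicIsotropy

end
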